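import Summits.AtomisticToContinuum.FouriersLaw.Theses.OddSectorIrreversibility

/-!
# `BoundedResponseConverges` / Negative: both stubs of the two-scale line are load-bearing

Negative knowledge for crux `stmt-AtomisticToContinuum-9141`
(`OddSectorIrreversibility.BoundedResponseConverges`), crux disprover, cycle 2 (2026-08-16).
Crux idea card `two-scale-gluing-log-rigidity` (triage r1: pass 3/3) closes the crux from two stubs on
the response sequence `D` with `R_N := (N-1)/D_N`: (U) `UpperIncrement` — eventually `0 < D_N` and
`R_{N+1} ≤ R_N + C`; (S23) `SelfSimilarGluing` — `R_{2N} ≤ 2R_N + Nε_N`, `R_{3N} ≤ 3R_N + Nε_N` with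
`ε` antitone and `∑_k ε(2^k) < ∞`; glue `LogScaleRigidity` (kernel-checked by the ideator). The two
theorems below are sequence-level witnesses that EACH stub is load-bearing even granted a floor and a
ceiling on `D_N` (and the chain-specific `D 0 = D 1 = 0`):

* `boundedResponseConverges_selfSimilar_not_sufficient` — `D_N = 4·[5 ∣ N] + 2·[5 ∤ N]` is EXACTLY
  invariant under `N ↦ 2N, 3N`, satisfies (S23) with `ε_N = 2/(N+1)`, and oscillates: no
  `×2/×3`-only information sees `N mod 5`; the log-Lipschitz modulus of (U) is essential.
* `boundedResponseConverges_upperIncrement_not_sufficient` — `D_N = 2 +` (triangular wave in `log₂ N`)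
  has modulus `|D_{N+1} - D_N| ≤ 2/(N+1)`, hence (U) with `C = 2`, and oscillates between `2` at
  `N = 4^m` and `3` at `N = 2·4^m`: (S23) is essential.
Companion file `TwoScaleKillCriteria.lean`: kill criteria and the parity witness. Pure real analysis;
nothing here closes an item.
-/

noncomputable section

namespace Summit.AtomisticToContinuum.FouriersLaw.Theorems

open Filter Topology

/-- **(S23) without (U) is insufficient** (sequence level, with floor and ceiling): there is
`D : ℕ → ℝ` with `D 0 = D 1 = 0`, `2 ≤ D N ≤ 4` (`N ≥ 2`), `|D|` bounded, `D (2N) = D (3N) = D N`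
(`N ≥ 2`) — hence the resistance form of (S23), `(2N-1)/D_{2N} ≤ 2 (N-1)/D_N + N ε_N` and
`(3N-1)/D_{3N} ≤ 3 (N-1)/D_N + N ε_N` with `ε_N = 2/(N+1)` antitone and summable along `2^k` — which
does not converge (`D N = 4` if `5 ∣ N`, else `2`). [folklore] -/
theorem boundedResponseConverges_selfSimilar_not_sufficient :
    ∃ D : ℕ → ℝ, D 0 = 0 ∧ D 1 = 0 ∧ (∀ N : ℕ, 2 ≤ N → 2 ≤ D N ∧ D N ≤ 4) ∧
      BddAbove (Set.range fun N => |D N|) ∧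
      (∀ N : ℕ, 2 ≤ N → D (2 * N) = D N ∧ D (3 * N) = D N) ∧
      (∃ ε : ℕ → ℝ, Antitone ε ∧ Summable (fun k : ℕ => ε (2 ^ k)) ∧
        ∀ N : ℕ, 2 ≤ N →
          (2 * (N : ℝ) - 1) / D (2 * N) ≤ 2 * (((N : ℝ) - 1) / D N) + N * ε N ∧
          (3 * (N : ℝ) - 1) / D (3 * N) ≤ 3 * (((N : ℝ) - 1) / D N) + N * ε N) ∧
      ¬ ∃ k : ℝ, Tendsto D atTop (𝓝 k) := by
  set D : ℕ → ℝ := fun N => if N < 2 then 0 else if 5 ∣ N then 4 else 2 with hD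
  have hval : ∀ N : ℕ, 2 ≤ N → D N = if 5 ∣ N then 4 else 2 := fun N hN => by
    have h : ¬ N < 2 := by omega
    simp only [hD, h, if_false]
  have hbounds : ∀ N : ℕ, 2 ≤ N → 2 ≤ D N ∧ D N ≤ 4 := fun N hN => by
    rw [hval N hN]; split_ifs <;> norm_num
  have h2 : ∀ N : ℕ, 2 ≤ N → D (2 * N) = D N := fun N hN => by
    rw [hval N hN, hval (2 * N) (by omega)]
    have : (5 ∣ 2 * N) ↔ (5 ∣ N) :=
      ⟨fun h => (Nat.Coprime.dvd_of_dvd_mul_left (by norm_num) h), fun h => dvd_mul_of_dvd_right h 2⟩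
    simp only [this]
  have h3 : ∀ N : ℕ, 2 ≤ N → D (3 * N) = D N := fun N hN => by
    rw [hval N hN, hval (3 * N) (by omega)]
    have : (5 ∣ 3 * N) ↔ (5 ∣ N) :=
      ⟨fun h => (Nat.Coprime.dvd_of_dvd_mul_left (by norm_num) h), fun h => dvd_mul_of_dvd_right h 3⟩
    simp only [this]
  refine ⟨D, by simp [hD], by simp [hD], hbounds, ⟨4, ?_⟩, fun N hN => ⟨h2 N hN, h3 N hN⟩,
    ⟨fun N => 2 / ((N : ℝ) + 1), ?_, ?_, fun N hN => ?_⟩, ?_⟩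
  · rintro _ ⟨N, rfl⟩
    dsimp only
    by_cases hN : 2 ≤ N
    · obtain ⟨hl, hu⟩ := hbounds N hN
      rw [abs_of_nonneg (by linarith)]; exact hu
    · have hlt : N < 2 := by omega
      have h0 : D N = 0 := by simp only [hD]; exact if_pos hlt
      rw [h0]; norm_num
  · intro a b hab
    dsimp only
    exact div_le_div_of_nonneg_left (by norm_num) (by positivity)
      (by exact_mod_cast Nat.add_le_add_right hab 1)
  · refine Summable.of_nonneg_of_le (fun k => by positivity) (fun k => ?_)
      ((summable_geometric_two).mul_left 2)
    push_cast
    rw [div_le_iff₀ (by positivity)]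
    have h1 : ((1 : ℝ) / 2) ^ k * 2 ^ k = 1 := by rw [← mul_pow]; norm_num
    nlinarith [h1, pow_pos (show (0 : ℝ) < 1 / 2 by norm_num) k]
  · obtain ⟨hl, hu⟩ := hbounds N hN
    have hN1 : (2 : ℝ) ≤ N := by exact_mod_cast hN
    have hDpos : 0 < D N := by linarith
    have hslack : 1 ≤ (N : ℝ) * (2 / ((N : ℝ) + 1)) := by
      rw [mul_div_assoc', le_div_iff₀ (by positivity)]; linarith
    have hinv : 1 / D N ≤ 1 / 2 := one_div_le_one_div_of_le (by norm_num) hl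
    rw [h2 N hN, h3 N hN]
    have e2 : (2 * (N : ℝ) - 1) / D N = 2 * (((N : ℝ) - 1) / D N) + 1 / D N := by
      field_simp; ring
    have e3 : (3 * (N : ℝ) - 1) / D N = 3 * (((N : ℝ) - 1) / D N) + 2 * (1 / D N) := by
      field_simp; ring
    rw [e2, e3]
    constructor <;> linarith
  · rintro ⟨k, hlim⟩
    have hsub_a : Tendsto (fun M : ℕ => 5 * (M + 1)) atTop atTop :=
      tendsto_atTop_atTop.2 fun b => ⟨b, fun M hM => by omega⟩
    have hsub_b : Tendsto (fun M : ℕ => 5 * (M + 1) + 1) atTop atTop :=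
      tendsto_atTop_atTop.2 fun b => ⟨b, fun M hM => by omega⟩
    have ha : Tendsto (fun M : ℕ => D (5 * (M + 1))) atTop (𝓝 k) := hlim.comp hsub_a
    have hb : Tendsto (fun M : ℕ => D (5 * (M + 1) + 1)) atTop (𝓝 k) := hlim.comp hsub_b
    have ha4 : Tendsto (fun M : ℕ => D (5 * (M + 1))) atTop (𝓝 4) := by
      refine tendsto_const_nhds.congr fun M => ?_
      rw [hval _ (by omega)]
      simp
    have hb2 : Tendsto (fun M : ℕ => D (5 * (M + 1) + 1)) atTop (𝓝 2) := by
      refine tendsto_const_nhds.congr fun M => ?_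
      rw [hval _ (by omega)]
      have : ¬ (5 ∣ 5 * (M + 1) + 1) := by omega
      simp [this]
    have h4 : k = 4 := tendsto_nhds_unique ha ha4
    have h2' : k = 2 := tendsto_nhds_unique hb hb2
    linarith

/-- **(U) without (S23) is insufficient** (sequence level, with floor and ceiling): there is
`D : ℕ → ℝ` with `D 0 = D 1 = 0`, `2 ≤ D N ≤ 3` (`N ≥ 2`), `|D|` bounded, log-Lipschitz modulus
`|D (N+1) - D N| ≤ 2/(N+1)`, hence bounded resistance increments `N/D_{N+1} ≤ (N-1)/D_N + 2` (the shape
of (U), with `0 < D_N`), which does not converge: `D N = 2 + z N`, `z` the triangular wave in `log₂ N`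
(`z N = (N-2^k)/2^k` on even blocks `k = ⌊log₂ N⌋`, `1 - (N-2^k)/2^k` on odd ones; `D (4^m) = 2`,
`D (2·4^m) = 3`). [folklore] -/
theorem boundedResponseConverges_upperIncrement_not_sufficient :
    ∃ D : ℕ → ℝ, D 0 = 0 ∧ D 1 = 0 ∧ (∀ N : ℕ, 2 ≤ N → 2 ≤ D N ∧ D N ≤ 3) ∧
      BddAbove (Set.range fun N => |D N|) ∧
      (∀ N : ℕ, 2 ≤ N → |D (N + 1) - D N| ≤ 2 / ((N : ℝ) + 1)) ∧
      (∀ N : ℕ, 2 ≤ N → 0 < D N ∧ (N : ℝ) / D (N + 1) ≤ ((N : ℝ) - 1) / D N + 2) ∧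
      ¬ ∃ k : ℝ, Tendsto D atTop (𝓝 k) := by
  -- the triangular wave in `log₂ N`
  set ph : ℕ → ℝ := fun N => ((N : ℝ) - 2 ^ Nat.log 2 N) / 2 ^ Nat.log 2 N with hph
  set z : ℕ → ℝ := fun N => if Even (Nat.log 2 N) then ph N else 1 - ph N with hz
  have ph_nonneg : ∀ N, 1 ≤ N → 0 ≤ ph N := fun N hN => by
    simp only [hph]
    apply div_nonneg _ (by positivity)
    have := Nat.pow_log_le_self 2 (show N ≠ 0 by omega)
    have : ((2 ^ Nat.log 2 N : ℕ) : ℝ) ≤ N := by exact_mod_cast this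
    push_cast at this
    linarith
  have ph_lt_one : ∀ N, ph N < 1 := fun N => by
    simp only [hph]
    rw [div_lt_one (by positivity)]
    have := Nat.lt_pow_succ_log_self (b := 2) one_lt_two N
    have : (N : ℝ) < ((2 ^ (Nat.log 2 N + 1) : ℕ) : ℝ) := by exact_mod_cast this
    push_cast at this
    have hp : (2 : ℝ) ^ (Nat.log 2 N + 1) = 2 ^ Nat.log 2 N * 2 := pow_succ _ _
    linarith
  have zmem : ∀ N, 1 ≤ N → 0 ≤ z N ∧ z N ≤ 1 := fun N hN => by
    have h0 := ph_nonneg N hN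
    have h1 := ph_lt_one N
    simp only [hz]
    split_ifs <;> constructor <;> linarith
  have zpow : ∀ k : ℕ, z (2 ^ k) = if Even k then 0 else 1 := fun k => by
    have hk : Nat.log 2 (2 ^ k) = k := Nat.log_pow one_lt_two _
    have hph0 : ph (2 ^ k) = 0 := by simp only [hph]; rw [hk]; push_cast; simp
    simp only [hz]; rw [hk, hph0]; split_ifs <;> simp
  have zstep : ∀ N, 1 ≤ N → |z (N + 1) - z N| ≤ 2 / ((N : ℝ) + 1) := fun N hN => by
    set k := Nat.log 2 N with hk
    have hlow : 2 ^ k ≤ N := Nat.pow_log_le_self 2 (by omega)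
    have hup : N < 2 ^ (k + 1) := Nat.lt_pow_succ_log_self one_lt_two N
    have hpos : (0 : ℝ) < 2 ^ k := by positivity
    -- first: the step is exactly `1/2^k`
    have hexact : |z (N + 1) - z N| = 1 / 2 ^ k := by
      by_cases hb : N + 1 < 2 ^ (k + 1)
      · have hk1 : Nat.log 2 (N + 1) = k := Nat.log_eq_of_pow_le_of_lt_pow (by omega) hb
        have hd : ph (N + 1) - ph N = 1 / 2 ^ k := by
          simp only [hph]; rw [hk1, ← hk]; push_cast; field_simp; ring
        simp only [hz]; rw [hk1, ← hk]
        split_ifs with he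
        · rw [hd, abs_of_pos (by positivity)]
        · rw [show 1 - ph (N + 1) - (1 - ph N) = -(ph (N + 1) - ph N) by ring, hd, abs_neg,
            abs_of_pos (by positivity)]
      · have heq : N + 1 = 2 ^ (k + 1) := by omega
        have hk1 : Nat.log 2 (N + 1) = k + 1 := by rw [heq]; exact Nat.log_pow one_lt_two _
        have hcast : (N : ℝ) + 1 = 2 ^ (k + 1) := by
          have : ((N + 1 : ℕ) : ℝ) = ((2 ^ (k + 1) : ℕ) : ℝ) := by rw [heq]
          push_cast at this; exact this
        have hph1 : ph (N + 1) = 0 := by simp only [hph]; rw [hk1]; push_cast; rw [hcast]; simp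
        have hph0' : ph N = 1 - 1 / 2 ^ k := by
          simp only [hph]; rw [← hk]
          have : (N : ℝ) = 2 ^ (k + 1) - 1 := by linarith
          rw [this]; field_simp; ring
        simp only [hz]; rw [hk1, ← hk, hph1, hph0']
        have hne : Even (k + 1) ↔ ¬ Even k := by rw [Nat.even_add_one]
        by_cases he : Even k
        · have : ¬ Even (k + 1) := fun h => (hne.1 h) he
          simp only [he, this, if_true, if_false]
          rw [show (1 : ℝ) - 0 - (1 - 1 / 2 ^ k) = 1 / 2 ^ k by ring, abs_of_pos (by positivity)]
        · have : Even (k + 1) := hne.2 he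
          simp only [he, this, if_true, if_false]
          rw [show (0 : ℝ) - (1 - (1 - 1 / 2 ^ k)) = -(1 / 2 ^ k) by ring, abs_neg,
            abs_of_pos (by positivity)]
    rw [hexact]
    have hup' : (N : ℝ) + 1 ≤ 2 ^ (k + 1) := by
      have : N + 1 ≤ 2 ^ (k + 1) := hup
      exact_mod_cast this
    rw [div_le_div_iff₀ (by positivity) (by positivity)]
    rw [pow_succ] at hup'
    linarith
  -- the witness
  set D : ℕ → ℝ := fun N => if N < 2 then 0 else 2 + z N with hD
  have hval : ∀ N : ℕ, 2 ≤ N → D N = 2 + z N := fun N hN => by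
    have h : ¬ N < 2 := by omega
    simp only [hD, h, if_false]
  have hbounds : ∀ N : ℕ, 2 ≤ N → 2 ≤ D N ∧ D N ≤ 3 := fun N hN => by
    rw [hval N hN]; have := zmem N (by omega); constructor <;> linarith
  have hstep : ∀ N : ℕ, 2 ≤ N → |D (N + 1) - D N| ≤ 2 / ((N : ℝ) + 1) := fun N hN => by
    rw [hval N hN, hval (N + 1) (by omega), show 2 + z (N + 1) - (2 + z N) = z (N + 1) - z N by ring]
    exact zstep N (by omega)
  refine ⟨D, by simp [hD], by simp [hD], hbounds, ⟨3, ?_⟩, hstep, fun N hN => ?_, ?_⟩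
  · rintro _ ⟨N, rfl⟩
    dsimp only
    by_cases hN : 2 ≤ N
    · obtain ⟨hl, hu⟩ := hbounds N hN
      rw [abs_of_nonneg (by linarith)]; exact hu
    · have hlt : N < 2 := by omega
      have h0 : D N = 0 := by simp only [hD]; exact if_pos hlt
      rw [h0]; norm_num
  · obtain ⟨hl, hu⟩ := hbounds N hN
    obtain ⟨hl1, hu1⟩ := hbounds (N + 1) (by omega)
    have hs := hstep N hN
    have hN2 : (2 : ℝ) ≤ N := by exact_mod_cast hN
    refine ⟨by linarith, ?_⟩
    have hdiff : (N : ℝ) * (D N - D (N + 1)) ≤ 2 := by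
      have h1 : D N - D (N + 1) ≤ 2 / ((N : ℝ) + 1) := by
        have := neg_abs_le (D (N + 1) - D N); linarith
      have h2 : (N : ℝ) * (2 / ((N : ℝ) + 1)) ≤ 2 := by
        rw [mul_div_assoc', div_le_iff₀ (by positivity)]; linarith
      nlinarith
    rw [div_add' _ _ _ (by linarith : D N ≠ 0), div_le_div_iff₀ (by linarith) (by linarith)]
    nlinarith [mul_nonneg (by linarith : (0 : ℝ) ≤ D N - 2) (by linarith : (0 : ℝ) ≤ D (N + 1) - 2)]
  · rintro ⟨k, hlim⟩
    have hsub_e : Tendsto (fun m : ℕ => 2 ^ (2 * (m + 1))) atTop atTop :=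
      tendsto_pow_atTop_atTop_of_one_lt one_lt_two |>.comp
        (tendsto_atTop_atTop.2 fun b => ⟨b, fun m hm => by omega⟩)
    have hsub_o : Tendsto (fun m : ℕ => 2 ^ (2 * (m + 1) + 1)) atTop atTop :=
      tendsto_pow_atTop_atTop_of_one_lt one_lt_two |>.comp
        (tendsto_atTop_atTop.2 fun b => ⟨b, fun m hm => by omega⟩)
    have he : Tendsto (fun m : ℕ => D (2 ^ (2 * (m + 1)))) atTop (𝓝 k) := hlim.comp hsub_e
    have ho : Tendsto (fun m : ℕ => D (2 ^ (2 * (m + 1) + 1))) atTop (𝓝 k) := hlim.comp hsub_o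
    have hpow2 : ∀ n, 1 ≤ n → 2 ≤ 2 ^ n := fun n hn => by
      calc 2 = 2 ^ 1 := by norm_num
        _ ≤ 2 ^ n := Nat.pow_le_pow_right (by norm_num) hn
    have he2 : Tendsto (fun m : ℕ => D (2 ^ (2 * (m + 1)))) atTop (𝓝 2) := by
      refine tendsto_const_nhds.congr fun m => ?_
      rw [hval _ (hpow2 _ (by omega)), zpow]
      have : Even (2 * (m + 1)) := even_two_mul _
      simp [this]
    have ho3 : Tendsto (fun m : ℕ => D (2 ^ (2 * (m + 1) + 1))) atTop (𝓝 3) := by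
      refine tendsto_const_nhds.congr fun m => ?_
      rw [hval _ (hpow2 _ (by omega)), zpow]
      have : ¬ Even (2 * (m + 1) + 1) := Nat.not_even_iff_odd.2 (odd_two_mul_add_one _)
      simp only [this, if_false]
      norm_num
    have h2 : k = 2 := tendsto_nhds_unique he he2
    have h3 : k = 3 := tendsto_nhds_unique ho ho3
    linarith

/-- **(U) forces a conductance floor** (shape level): if eventually `0 < D_N` and
`N/D_{N+1} ≤ (N-1)/D_N + C` (i.e. `R_{N+1} ≤ R_N + C`, `R_N = (N-1)/D_N`), then `D_N ≥ c > 0`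
eventually (`R_N` grows at most linearly). [folklore] -/
theorem boundedResponseConverges_floor_of_upperIncrement {D : ℕ → ℝ}
    (h : ∃ C : ℝ, ∃ N₀ : ℕ, ∀ N : ℕ, N₀ ≤ N →
      0 < D N ∧ (N : ℝ) / D (N + 1) ≤ ((N : ℝ) - 1) / D N + C) :
    ∃ c : ℝ, 0 < c ∧ ∃ N₁ : ℕ, ∀ N : ℕ, N₁ ≤ N → c ≤ D N := by
  obtain ⟨C, N₀, hU⟩ := h
  set R : ℕ → ℝ := fun N => ((N : ℝ) - 1) / D N with hRdef
  have hU0 : ∀ N, N₀ ≤ N → 0 < D N ∧ R (N + 1) ≤ R N + C := fun N hN => by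
    obtain ⟨h1, h2⟩ := hU N hN
    refine ⟨h1, ?_⟩
    simp only [hRdef]; push_cast
    rw [show (N : ℝ) + 1 - 1 = N by ring]; exact h2
  set N₁ := max N₀ 2 with hN₁
  have hU' : ∀ N, N₁ ≤ N → 0 < D N ∧ R (N + 1) ≤ R N + C := fun N hN =>
    hU0 N (le_trans (le_max_left _ _) hN)
  have hN₁2 : 2 ≤ N₁ := le_max_right _ _
  set C' := max C 1 with hC'
  have hC'pos : 0 < C' := lt_of_lt_of_le one_pos (le_max_right _ _)
  set R₀ := R N₁ with hR₀
  have hR₀pos : 0 < R₀ := by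
    have hD := (hU' N₁ le_rfl).1
    have : (2 : ℝ) ≤ N₁ := by exact_mod_cast hN₁2
    simp only [hR₀, hRdef]
    exact div_pos (by linarith) hD
  have hlin : ∀ m : ℕ, R (N₁ + m) ≤ R₀ + C' * m := by
    intro m
    induction m with
    | zero => simp [hR₀]
    | succ m ih =>
      have hstep := (hU' (N₁ + m) (Nat.le_add_right _ _)).2
      have hCC : C ≤ C' := le_max_left _ _
      rw [show N₁ + (m + 1) = N₁ + m + 1 by ring]
      push_cast
      nlinarith
  refine ⟨1 / (2 * (R₀ + C')), by positivity, N₁, fun N hN => ?_⟩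
  obtain ⟨m, rfl⟩ := Nat.exists_eq_add_of_le hN
  have hD := (hU' (N₁ + m) hN).1
  have hm0 : (0 : ℝ) ≤ m := by positivity
  have hkey : ((N₁ + m : ℕ) : ℝ) - 1 ≤ (R₀ + C' * m) * D (N₁ + m) := by
    have := hlin m
    simp only [hRdef] at this
    rw [div_le_iff₀ hD] at this
    exact this
  have hX : 0 < R₀ + C' * m := by positivity
  have hn1 : (m : ℝ) + 1 ≤ ((N₁ + m : ℕ) : ℝ) - 1 := by
    push_cast
    have : (2 : ℝ) ≤ N₁ := by exact_mod_cast hN₁2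
    linarith
  have hA : R₀ + C' * m ≤ 2 * (R₀ + C') * (((N₁ + m : ℕ) : ℝ) - 1) := by
    have hRC : 0 ≤ R₀ + C' := by positivity
    nlinarith [mul_le_mul_of_nonneg_left hn1 hRC, hR₀pos.le, hC'pos.le, hm0]
  have hC2 : 0 ≤ 2 * (R₀ + C') := by positivity
  have h3 : R₀ + C' * m ≤ 2 * (R₀ + C') * ((R₀ + C' * m) * D (N₁ + m)) :=
    le_trans hA (mul_le_mul_of_nonneg_left hkey hC2)
  have h4 : (R₀ + C' * m) * 1 ≤ (R₀ + C' * m) * (D (N₁ + m) * (2 * (R₀ + C'))) := by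
    have : 2 * (R₀ + C') * ((R₀ + C' * m) * D (N₁ + m)) =
        (R₀ + C' * m) * (D (N₁ + m) * (2 * (R₀ + C'))) := by ring
    linarith [h3, this]
  rw [div_le_iff₀ (by positivity)]
  exact le_of_mul_le_mul_left h4 hX

end Summit.AtomisticToContinuum.FouriersLaw.Theorems

end
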